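import Literature.MathematicalPhysics.QuantumFieldTheory.Balaban1983to89.Beta.PlaquetteWeitzenbock

/-!
# `Beta.PlaquetteStencil` — the exact first-order vertex family of the Wilson action at a one-bond background as ONE finite
# stencil matrix: `−½·jet21 = ½·vᵀ (wilsonVertex₁ e z γ (adM Y)) v` for every fluctuation `v`

HONEST FRAMING (cell `pub-balaban`, β sub-cell, analysis prover AN3, generation 11, third node).  Discharging `BetaPertH`
would make Bałaban's ultraviolet stability UNCONDITIONAL — a real constructive-QFT result; it is NOT the continuum limit and NOT
the Clay problem.  This file discharges nothing of the kind: it is FINITE NON-COMMUTATIVE ALGEBRA on a finite periodic lattice in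
coordinates, kernel-checked, continuing `Beta.PlaquetteVertex` (the `(2,1)`-jet and its split) and `Beta.PlaquetteWeitzenbock` (the
lattice Weitzenböck identity).  Value = a kernel certificate for the β-function bookkeeping «which term of the ACTUAL plaquette action
produces which table coefficient» (the `(D1-rep)` dictionary of the cell): the first-order vertex family is now a DEFINED finite
matrix, NOT summit progress.

ABSOLUTE RULE.  No internally-minted statement enters as a cited fact.  Every statement below is kernel-proved; the only
literature locus named (T. Bałaban, *Propagators for lattice gauge theories in a background field*, Comm. Math. Phys. **99** (1985)
389–434 [Balaban1985BackgroundPropagators] = cell paper B9, pp. 391–392: the expansion (3.7) of the Wilson action around a background,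
its quadratic form (3.10) `⟨A, Δ(U)A⟩` and the bookkeeping (3.12)) is CONTEXT for the reader — which printed object this matrix is the
`B`-linear one-bond germ of — and nothing printed is used as a hypothesis.  The manuscripts under audit are not citable for their
disputed steps and are not cited for any step here.

WHAT IS PROVED.  Setting of `PlaquetteVertex` §3: a real algebra `𝔸` with a tracial linear functional `τ`, colour letters
`t : C → 𝔸`, a finite periodic lattice `Λ` with unit vectors `e : D → Λ`, fluctuation in coordinates `W = field t v`
(`W_k(x) = Σ_a v(x,a,k)·t_a`), background ONE bond letter `B = bondLetter z γ Y`, colour matrix `adM τ t Y` (`(a,b) ↦ τ(Y[t_a,t_b])`).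

* §1 DIRECTION BLOCKS AND LOCATED PAIRS.  `dirBlock α β A = A ⊗ e_{αβ}` on `C × D` and `pairIns x y α β A := BubbleTable.elemIns x y
  (dirBlock α β A)` on `Λ × (C × D)`; the one identity everything rests on: `τ(Y·[W_α(x), W_β(y)]) = v ⬝ᵥ (pairIns x y α β (adM Y)) v`
  (`trace_br_field_field`).  `SpinTable.spinMat β γ A = dirBlock β γ A − dirBlock γ β A` (`spinMat_eq_dirBlock_sub`).
* §2 THE ONE-BOND COLLAPSE.  For ANY plaquette-indexed family `G`,
  `Σ_x Σ_{μν} τ((lcurl e (bondLetter z γ Y))_{μν}(x) · G_{μν}(x)) = Σ_μ (τ(Y·G_{μγ}(z−e_μ)) − τ(Y·G_{μγ}(z)) − τ(Y·G_{γμ}(z−e_μ)) + τ(Y·G_{γμ}(z)))`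
  (`sum_lcurl_bondLetter_mul`): the curl of a one-bond letter lives on the `2(d−1)`-type family of plaquettes through the bond.
* §3 THE FOUR REMAINING FORMS OF `jet21_weitzenbock` AT A ONE-BOND BACKGROUND, ring level and in coordinates:
  `divGerm = Σ_μ τ(Y·[W_γ(z), W_μ(z+e_γ) − W_μ(z+e_γ−e_μ)]) = v ⬝ᵥ (divVertex e z γ (adM Y)) v`;
  `spinFarDiff = v ⬝ᵥ (spinFarDiffVertex …) v`; `spinDiff = v ⬝ᵥ (spinDiffVertex …) v`; `transportF = v ⬝ᵥ (transportFVertex …) v` —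
  each vertex an explicit finite sum of located pairs within two lattice steps of `z` (definitions displayed; `spinLocal` and
  `gradGerm` were typed in `PlaquetteVertex.spinLocal_field_bondLetter` / `PlaquetteWeitzenbock.gradGerm_field_bondLetter`).
* §4 **HEADLINE** (`actionJet21_eq_wilsonVertex₁`).  In the Hessian convention `S₂ = ½·vᵀHv` for `S = Σ_p (1 − Re τU(∂p))`
  (`(2,1)`-jet `= −½·jet21`), for EVERY `v` and tracial `τ`:
  `−½·jet21 ℝ τ e (field t v) (bondLetter z γ Y) = ½ · v ⬝ᵥ (wilsonVertex₁ e z γ (adM τ t Y) *ᵥ v)`,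
  `wilsonVertex₁ := SpinTable.vecVertex sTot + 2•divVertex + remVertex₁`, `sTot = −2` (`PlaquetteWeitzenbock`),
  `remVertex₁ := −½•spinDiffVertex + transportFVertex − spinFarDiffVertex` (grading (t) ≥ 2 of `PlaquetteVertex`'s header: every
  term carries a lattice difference of a fluctuation leg).  So the Wilson action's `B`-linear one-bond Hessian vertex IS the matrix
  MODEL VECTOR VERTEX (current ⊗ 1 + sTot·spin, `SpinTable`) + LONGITUDINAL VERTEX + EXPLICIT REMAINDER VERTEX — a finite stencil, defined,
  not estimated.  `_gen`: Bałaban's letters verbatim (`ColourTrace.adMat τ (τ c)`).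

NOT PROVED HERE, NOT CLAIMED: any estimate or table value of the remainder vertex (its bubble against `BubbleTable`'s tables is the
successor «log-free remainder» item); the `(2,2)` contact vertex (P22); gauge fixing / the fate of the longitudinal vertex (B9 (3.26));
anything about `BetaPertH`, the continuum limit or the Clay problem.  All declarations are tagged `[folklore]`: finite algebra.
-/

namespace Literature.MathematicalPhysics.QuantumFieldTheory.Balaban1983to89.Beta.PlaquetteStencil

open Finset
open scoped BigOperators Matrix
open Literature.MathematicalPhysics.QuantumFieldTheory.Balaban1983to89.Beta.BubbleTable (elemIns elemIns_apply)
open Literature.MathematicalPhysics.QuantumFieldTheory.Balaban1983to89.Beta.GhostTable (current copies)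
open Literature.MathematicalPhysics.QuantumFieldTheory.Balaban1983to89.Beta.SpinTable (br spinVertex vecVertex spinMat spinMat_apply
  spinDir spinDir_apply)
open Literature.MathematicalPhysics.QuantumFieldTheory.Balaban1983to89.Beta.ColourTrace (adMat)
open Literature.MathematicalPhysics.QuantumFieldTheory.Balaban1983to89.Beta.PlaquetteVertex
open Literature.MathematicalPhysics.QuantumFieldTheory.Balaban1983to89.Beta.PlaquetteWeitzenbock

/-! ## §1 Direction blocks and located pairs -/

section Blocks

variable {C : Type*} [Fintype C] [DecidableEq C] {D : Type*} [Fintype D] [DecidableEq D]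

/-- THE DIRECTION BLOCK `A ⊗ e_{αβ}` on `C × D`: entries `((a,k),(b,k′)) ↦ [k = α][k′ = β]·A_{ab}`.  A definition asserting nothing.
[folklore] -/
def dirBlock (α β : D) (A : Matrix C C ℝ) : Matrix (C × D) (C × D) ℝ :=
  Matrix.of fun i j => if i.2 = α ∧ j.2 = β then A i.1 j.1 else 0

omit [Fintype C] [DecidableEq C] [Fintype D] in
/-- entries. [folklore] -/
@[simp] theorem dirBlock_apply (α β : D) (A : Matrix C C ℝ) (a b : C) (k k' : D) :
    dirBlock α β A (a, k) (b, k') = if k = α ∧ k' = β then A a b else 0 := rfl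

omit [Fintype C] [DecidableEq C] [Fintype D] in
/-- CONSISTENCY WITH `SpinTable`: the antisymmetrised spin matrix is the difference of the two direction blocks,
`spinMat β γ A = dirBlock β γ A − dirBlock γ β A`. [folklore] -/
theorem spinMat_eq_dirBlock_sub (β γ : D) (A : Matrix C C ℝ) : spinMat β γ A = dirBlock β γ A - dirBlock γ β A := by
  ext ⟨a, k⟩ ⟨b, k'⟩
  simp only [spinMat_apply, spinDir_apply, Matrix.sub_apply, dirBlock_apply, mul_sub, mul_ite, mul_one, mul_zero, @eq_comm _ β k,
    @eq_comm _ γ k', @eq_comm _ γ k, @eq_comm _ β k']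

end Blocks

section Coordinates

variable {𝔸 : Type*} [Ring 𝔸] [Algebra ℝ 𝔸]
variable {Λ : Type*} [Fintype Λ] [DecidableEq Λ] [AddCommGroup Λ] {C : Type*} [Fintype C] [DecidableEq C]
  {D : Type*} [Fintype D] [DecidableEq D]

/-- THE LOCATED PAIR `pairIns x y α β A := elemIns x y (A ⊗ e_{αβ})`: the matrix on `Λ × (C × D)` supported on the single block
(site `x`, direction `α`) × (site `y`, direction `β`) with colour entries `A`.  A definition asserting nothing. [folklore] -/
def pairIns (x y : Λ) (α β : D) (A : Matrix C C ℝ) : Matrix (Λ × (C × D)) (Λ × (C × D)) ℝ := elemIns x y (dirBlock α β A)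

omit [AddCommGroup Λ] [DecidableEq C] in
/-- the bilinear form of a located pair: `v ⬝ᵥ (pairIns x y α β A) w = Σ_a Σ_b v(x,a,α)·A_{ab}·w(y,b,β)`. [folklore] -/
theorem dotProduct_pairIns_mulVec (x y : Λ) (α β : D) (A : Matrix C C ℝ) (v w : Λ × (C × D) → ℝ) :
    v ⬝ᵥ (pairIns x y α β A *ᵥ w) = ∑ a, ∑ b, v (x, (a, α)) * A a b * w (y, (b, β)) := by
  rw [pairIns, dotProduct_elemIns_mulVec, Fintype.sum_prod_type]
  refine Finset.sum_congr rfl fun a _ => ?_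
  rw [Finset.sum_eq_single_of_mem α (Finset.mem_univ α)]
  · rw [Fintype.sum_prod_type]
    refine Finset.sum_congr rfl fun b _ => ?_
    rw [Finset.sum_eq_single_of_mem β (Finset.mem_univ β)]
    · rw [dirBlock_apply, if_pos ⟨rfl, rfl⟩]
    · intro k' _ hk'
      rw [dirBlock_apply, if_neg (fun h => hk' h.2), mul_zero, zero_mul]
  · intro k _ hk
    rw [Fintype.sum_prod_type]
    refine Finset.sum_eq_zero fun b _ => Finset.sum_eq_zero fun k' _ => ?_
    rw [dirBlock_apply, if_neg (fun h => hk h.1), mul_zero, zero_mul]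

omit [AddCommGroup Λ] [DecidableEq C] in
/-- **THE ONE IDENTITY EVERYTHING RESTS ON**: the trace of a letter against the commutator of two coordinate fluctuation letters is the
bilinear form of the located pair, `τ(Y·[W_α(x), W_β(y)]) = v ⬝ᵥ (pairIns x y α β (adM Y)) v` (`PlaquetteVertex.trace_mul_br_sum`).
[folklore] -/
theorem trace_br_field_field (τ : 𝔸 →ₗ[ℝ] ℝ) (t : C → 𝔸) (v : Λ × (C × D) → ℝ) (Y : 𝔸) (x y : Λ) (α β : D) :
    τ (Y * br (field t v x α) (field t v y β)) = v ⬝ᵥ (pairIns x y α β (adM τ t Y) *ᵥ v) := by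
  rw [dotProduct_pairIns_mulVec]
  refine (trace_mul_br_sum τ t Y (fun a => v (x, (a, α))) (fun b => v (y, (b, β)))).trans ?_
  exact Finset.sum_congr rfl fun a _ => Finset.sum_congr rfl fun b _ => mul_right_comm _ _ _

omit [Fintype Λ] [DecidableEq Λ] [AddCommGroup Λ] [Fintype C] [DecidableEq C] [Fintype D] [DecidableEq D] in
/-- bookkeeping: the bilinear form of a finite sum of matrices. [folklore] -/
theorem dotProduct_sum_mulVec {ι : Type*} (s : Finset ι) (M : ι → Matrix (Λ × (C × D)) (Λ × (C × D)) ℝ)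
    [Fintype Λ] [Fintype C] [Fintype D] (v w : Λ × (C × D) → ℝ) :
    v ⬝ᵥ ((∑ i ∈ s, M i) *ᵥ w) = ∑ i ∈ s, v ⬝ᵥ (M i *ᵥ w) := by
  classical
  induction s using Finset.induction_on with
  | empty => simp
  | insert i s hi ih => rw [Finset.sum_insert hi, Finset.sum_insert hi, Matrix.add_mulVec, dotProduct_add, ih]

end Coordinates

/-! ## §2 The one-bond collapse of a curl-weighted plaquette sum -/

section Collapse

variable {𝕜 : Type*} [Semiring 𝕜] {𝔸 : Type*} [Ring 𝔸] [Module 𝕜 𝔸] {V : Type*} [AddCommGroup V] [Module 𝕜 V]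
variable {Λ : Type*} [Fintype Λ] [DecidableEq Λ] [AddCommGroup Λ] {D : Type*} [Fintype D] [DecidableEq D]

omit [Fintype Λ] [DecidableEq Λ] [AddCommGroup Λ] [Fintype D] [DecidableEq D] in
/-- the trace of a conditional letter times anything. [folklore] -/
theorem trace_ite_mul (τ : 𝔸 →ₗ[𝕜] V) (c : Prop) [Decidable c] (Y G : 𝔸) :
    τ ((if c then Y else 0) * G) = if c then τ (Y * G) else 0 := by
  split_ifs <;> simp

omit [AddCommGroup Λ] in
/-- the located double sum: `Σ_x Σ_ν [x = s][ν = γ]·f x ν = f s γ`. [folklore] -/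
theorem sum_site_dir_ite (f : Λ → D → V) (s : Λ) (γ : D) :
    (∑ x, ∑ ν, if x = s ∧ ν = γ then f x ν else 0) = f s γ := by
  simp_rw [ite_and]
  rw [Finset.sum_eq_single_of_mem s (Finset.mem_univ s)]
  · simp only [↓reduceIte, Finset.sum_ite_eq', Finset.mem_univ]
  · intro x _ hx
    simp only [if_neg hx, Finset.sum_const_zero]

omit [AddCommGroup Λ] in
/-- the located double sum, direction outside: `Σ_μ Σ_x [x = s][μ = γ]·f x μ = f s γ`. [folklore] -/
theorem sum_dir_site_ite (f : Λ → D → V) (s : Λ) (γ : D) :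
    (∑ μ, ∑ x, if x = s ∧ μ = γ then f x μ else 0) = f s γ := by
  rw [Finset.sum_comm]
  exact sum_site_dir_ite f s γ

/-- **THE ONE-BOND COLLAPSE**: for ANY plaquette-indexed family `G`,
`Σ_x Σ_{μν} τ((lcurl e (bondLetter z γ Y))_{μν}(x) · G_{μν}(x)) = Σ_μ (τ(Y·G_{μγ}(z−e_μ)) − τ(Y·G_{μγ}(z)) − τ(Y·G_{γμ}(z−e_μ)) + τ(Y·G_{γμ}(z)))`
— the four plaquette readings of the one bond `(z, γ)` per transverse direction `μ` (the `μ = γ` summand vanishes identically).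
[folklore] -/
theorem sum_lcurl_bondLetter_mul (τ : 𝔸 →ₗ[𝕜] V) (e : D → Λ) (z : Λ) (γ : D) (Y : 𝔸) (G : Λ → D → D → 𝔸) :
    ∑ x, ∑ μ, ∑ ν, τ (lcurl e (bondLetter z γ Y) x μ ν * G x μ ν) =
      ∑ μ, (τ (Y * G (z - e μ) μ γ) - τ (Y * G z μ γ) - τ (Y * G (z - e μ) γ μ) + τ (Y * G z γ μ)) := by
  have h1 : ∑ x, ∑ μ, ∑ ν, τ (bondLetter z γ Y (x + e μ) ν * G x μ ν) = ∑ μ, τ (Y * G (z - e μ) μ γ) := by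
    rw [sum_x_comm₂]
    refine Finset.sum_congr rfl fun μ _ => ?_
    simp only [bondLetter, trace_ite_mul]
    simp_rw [← eq_sub_iff_add_eq]
    exact sum_site_dir_ite (fun x ν => τ (Y * G x μ ν)) (z - e μ) γ
  have h2 : ∑ x, ∑ μ, ∑ ν, τ (bondLetter z γ Y x ν * G x μ ν) = ∑ μ, τ (Y * G z μ γ) := by
    rw [sum_x_comm₂]
    refine Finset.sum_congr rfl fun μ _ => ?_
    simp only [bondLetter, trace_ite_mul]
    exact sum_site_dir_ite (fun x ν => τ (Y * G x μ ν)) z γ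
  have h3 : ∑ x, ∑ μ, ∑ ν, τ (bondLetter z γ Y (x + e ν) μ * G x μ ν) = ∑ ν, τ (Y * G (z - e ν) γ ν) := by
    rw [sum_x_comm₃]
    rw [Finset.sum_comm]
    refine Finset.sum_congr rfl fun ν _ => ?_
    simp only [bondLetter, trace_ite_mul]
    simp_rw [← eq_sub_iff_add_eq]
    exact sum_dir_site_ite (fun x μ => τ (Y * G x μ ν)) (z - e ν) γ
  have h4 : ∑ x, ∑ μ, ∑ ν, τ (bondLetter z γ Y x μ * G x μ ν) = ∑ ν, τ (Y * G z γ ν) := by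
    rw [sum_x_comm₃]
    rw [Finset.sum_comm]
    refine Finset.sum_congr rfl fun ν _ => ?_
    simp only [bondLetter, trace_ite_mul]
    exact sum_dir_site_ite (fun x μ => τ (Y * G x μ ν)) z γ
  simp only [lcurl, sub_mul, map_sub, Finset.sum_sub_distrib, h1, h2, h3, h4, Finset.sum_add_distrib]
  abel

end Collapse

/-! ## §3 The four remaining forms at a one-bond background -/

section FormsAtBond

variable {𝕜 : Type*} [Semiring 𝕜] {𝔸 : Type*} [Ring 𝔸] [Module 𝕜 𝔸] {V : Type*} [AddCommGroup V] [Module 𝕜 V]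
variable {Λ : Type*} [Fintype Λ] [DecidableEq Λ] [AddCommGroup Λ] {D : Type*} [Fintype D] [DecidableEq D]

omit [Fintype Λ] in
/-- the backward twist of a one-bond letter sits at the far endpoint: `divTwist e W (bondLetter z γ Y) x = [x = z + e_γ]·[Y, W_γ(z)]`.
[folklore] -/
theorem divTwist_bondLetter (e : D → Λ) (W : Λ → D → 𝔸) (z : Λ) (γ : D) (Y : 𝔸) (x : Λ) :
    divTwist e W (bondLetter z γ Y) x = if x = z + e γ then br Y (W z γ) else 0 := by
  simp only [divTwist, bondLetter]
  split_ifs with hx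
  · rw [Finset.sum_eq_single_of_mem γ (Finset.mem_univ γ)]
    · rw [if_pos ⟨by rw [hx, add_sub_cancel_right], rfl⟩, hx, add_sub_cancel_right]
    · intro μ _ hμ
      rw [if_neg (fun h => hμ h.2), br_zero_left]
  · refine Finset.sum_eq_zero fun μ _ => ?_
    by_cases h : x - e μ = z ∧ μ = γ
    · exact absurd (by rw [← h.1, h.2, sub_add_cancel]) hx
    · rw [if_neg h, br_zero_left]

/-- **THE LONGITUDINAL GERM AT A ONE-BOND BACKGROUND** (tracial `τ`):
`divGerm τ e W (bondLetter z γ Y) = Σ_μ (τ(Y·[W_γ(z), W_μ(z+e_γ)]) − τ(Y·[W_γ(z), W_μ(z+e_γ−e_μ)]))` — the backward divergence of the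
fluctuation at the far endpoint `z + e_γ`, twisted by `Y` against `W_γ(z)`. [folklore] -/
theorem divGerm_bondLetter (τ : 𝔸 →ₗ[𝕜] V) (hτ : ∀ a b : 𝔸, τ (a * b) = τ (b * a)) (e : D → Λ) (W : Λ → D → 𝔸) (z : Λ)
    (γ : D) (Y : 𝔸) :
    divGerm τ e W (bondLetter z γ Y) =
      ∑ μ, (τ (Y * br (W z γ) (W (z + e γ) μ)) - τ (Y * br (W z γ) (W (z + e γ - e μ) μ))) := by
  simp only [divGerm, divTwist_bondLetter, mul_ite, mul_zero]
  rw [show (∑ x, τ (if x = z + e γ then divW e W x * br Y (W z γ) else 0)) =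
      ∑ x, (if x = z + e γ then τ (divW e W x * br Y (W z γ)) else 0) from
    Finset.sum_congr rfl fun x _ => by split_ifs <;> simp]
  rw [Finset.sum_ite_eq' Finset.univ (z + e γ), if_pos (Finset.mem_univ _), trace_mul_br_cycl τ hτ, divW, br_sum_right,
    Finset.mul_sum, map_sum]
  refine Finset.sum_congr rfl fun μ _ => ?_
  rw [br_sub_right, mul_sub, map_sub]

/-- THE FAR-CORNER SPIN DIFFERENCE AT A ONE-BOND BACKGROUND (any linear `τ`), by the one-bond collapse with
`G_{μν}(x) = [W_μ(x+e_ν), W_ν(x+e_μ)] − [W_μ(x), W_ν(x)]`. [folklore] -/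
theorem spinFarDiff_bondLetter (τ : 𝔸 →ₗ[𝕜] V) (e : D → Λ) (W : Λ → D → 𝔸) (z : Λ) (γ : D) (Y : 𝔸) :
    spinFarDiff τ e W (bondLetter z γ Y) =
      ∑ μ, (τ (Y * (br (W (z - e μ + e γ) μ) (W (z - e μ + e μ) γ) - br (W (z - e μ) μ) (W (z - e μ) γ)))
        - τ (Y * (br (W (z + e γ) μ) (W (z + e μ) γ) - br (W z μ) (W z γ)))
        - τ (Y * (br (W (z - e μ + e μ) γ) (W (z - e μ + e γ) μ) - br (W (z - e μ) γ) (W (z - e μ) μ)))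
        + τ (Y * (br (W (z + e μ) γ) (W (z + e γ) μ) - br (W z γ) (W z μ)))) := by
  rw [spinFarDiff]
  exact sum_lcurl_bondLetter_mul τ e z γ Y (fun x μ ν => br (W (x + e ν) μ) (W (x + e μ) ν) - br (W x μ) (W x ν))

/-- THE SPIN DIFFERENCE FORM AT A ONE-BOND BACKGROUND (any linear `τ`), by the one-bond collapse with `G = pairDiff(…)`. [folklore] -/
theorem spinDiff_bondLetter (τ : 𝔸 →ₗ[𝕜] V) (e : D → Λ) (W : Λ → D → 𝔸) (z : Λ) (γ : D) (Y : 𝔸) :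
    spinDiff τ e W (bondLetter z γ Y) =
      ∑ μ, (τ (Y * pairDiff (W (z - e μ) μ) (W (z - e μ) γ) (W (z - e μ + e γ) μ - W (z - e μ) μ)
              (W (z - e μ + e μ) γ - W (z - e μ) γ))
        - τ (Y * pairDiff (W z μ) (W z γ) (W (z + e γ) μ - W z μ) (W (z + e μ) γ - W z γ))
        - τ (Y * pairDiff (W (z - e μ) γ) (W (z - e μ) μ) (W (z - e μ + e μ) γ - W (z - e μ) γ)
              (W (z - e μ + e γ) μ - W (z - e μ) μ))
        + τ (Y * pairDiff (W z γ) (W z μ) (W (z + e μ) γ - W z γ) (W (z + e γ) μ - W z μ))) := by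
  rw [spinDiff]
  exact sum_lcurl_bondLetter_mul τ e z γ Y
    (fun x μ ν => pairDiff (W x μ) (W x ν) (W (x + e ν) μ - W x μ) (W (x + e μ) ν - W x ν))

/-- THE `F`-PART OF THE TRANSPORT FORM AT A ONE-BOND BACKGROUND (tracial `τ`): first the cyclic rewrite
`τ(Z·[F, S]) = τ(F·[S, Z])` (`Z = lcurl W`, `S_{μν}(x) = W_μ(x+e_ν) + W_ν(x)`), then the one-bond collapse. [folklore] -/
theorem transportF_bondLetter (τ : 𝔸 →ₗ[𝕜] V) (hτ : ∀ a b : 𝔸, τ (a * b) = τ (b * a)) (e : D → Λ) (W : Λ → D → 𝔸) (z : Λ)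
    (γ : D) (Y : 𝔸) :
    transportF τ e W (bondLetter z γ Y) =
      ∑ μ, (τ (Y * br (W (z - e μ + e γ) μ + W (z - e μ) γ) (lcurl e W (z - e μ) μ γ))
        - τ (Y * br (W (z + e γ) μ + W z γ) (lcurl e W z μ γ))
        - τ (Y * br (W (z - e μ + e μ) γ + W (z - e μ) μ) (lcurl e W (z - e μ) γ μ))
        + τ (Y * br (W (z + e μ) γ + W z μ) (lcurl e W z γ μ))) := by
  have h : transportF τ e W (bondLetter z γ Y) =
      ∑ x, ∑ μ, ∑ ν, τ (lcurl e (bondLetter z γ Y) x μ ν * br (W (x + e ν) μ + W x ν) (lcurl e W x μ ν)) := by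
    simp only [transportF, trace_mul_br_cycl τ hτ (lcurl e W _ _ _)]
  rw [h]
  exact sum_lcurl_bondLetter_mul τ e z γ Y (fun x μ ν => br (W (x + e ν) μ + W x ν) (lcurl e W x μ ν))

end FormsAtBond

/-! ## §3′ The four remaining forms in coordinates: located-pair vertices -/

section Vertices

variable {𝔸 : Type*} [Ring 𝔸] [Algebra ℝ 𝔸]
variable {Λ : Type*} [Fintype Λ] [DecidableEq Λ] [AddCommGroup Λ] {C : Type*} [Fintype C] [DecidableEq C]
  {D : Type*} [Fintype D] [DecidableEq D]

/-- THE ONE-BOND SUM of a plaquette-local matrix family `K`: `Σ_μ (K_{μγ}(z−e_μ) − K_{μγ}(z) − K_{γμ}(z−e_μ) + K_{γμ}(z))` — the matrix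
side of the one-bond collapse `sum_lcurl_bondLetter_mul`.  A definition asserting nothing. [folklore] -/
def bondSum (e : D → Λ) (z : Λ) (γ : D) (K : Λ → D → D → Matrix (Λ × (C × D)) (Λ × (C × D)) ℝ) :
    Matrix (Λ × (C × D)) (Λ × (C × D)) ℝ :=
  ∑ μ, (K (z - e μ) μ γ - K z μ γ - K (z - e μ) γ μ + K z γ μ)

omit [DecidableEq C] in
/-- **THE ONE-BOND COLLAPSE IN COORDINATES**: if each plaquette reading `τ(Y·G_{αβ}(s))` is the bilinear form of `K_{αβ}(s)`, the
curl-weighted sum at the one-bond background is the bilinear form of `bondSum e z γ K`. [folklore] -/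
theorem collapse_quadratic (τ : 𝔸 →ₗ[ℝ] ℝ) (e : D → Λ) (z : Λ) (γ : D) (Y : 𝔸) (G : Λ → D → D → 𝔸)
    (K : Λ → D → D → Matrix (Λ × (C × D)) (Λ × (C × D)) ℝ) (v : Λ × (C × D) → ℝ)
    (hGK : ∀ s α β, τ (Y * G s α β) = v ⬝ᵥ (K s α β *ᵥ v)) :
    ∑ x, ∑ μ, ∑ ν, τ (lcurl e (bondLetter z γ Y) x μ ν * G x μ ν) = v ⬝ᵥ (bondSum e z γ K *ᵥ v) := by
  rw [sum_lcurl_bondLetter_mul, bondSum, dotProduct_sum_mulVec]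
  refine Finset.sum_congr rfl fun μ _ => ?_
  rw [Matrix.add_mulVec, Matrix.sub_mulVec, Matrix.sub_mulVec, dotProduct_add, dotProduct_sub, dotProduct_sub, hGK, hGK, hGK, hGK]

/-- THE LONGITUDINAL VERTEX `Σ_μ (pairIns z (z+e_γ) γ μ A − pairIns z (z+e_γ−e_μ) γ μ A)`: `W_γ(z)` against the backward divergence
of `W` at the far endpoint `z + e_γ` (`2d` located pairs).  A definition asserting nothing. [folklore] -/
def divVertex (e : D → Λ) (z : Λ) (γ : D) (A : Matrix C C ℝ) : Matrix (Λ × (C × D)) (Λ × (C × D)) ℝ :=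
  ∑ μ, (pairIns z (z + e γ) γ μ A - pairIns z (z + e γ - e μ) γ μ A)

omit [DecidableEq C] in
/-- **THE LONGITUDINAL GERM IN COORDINATES**: `divGerm τ e (field t v) (bondLetter z γ Y) = v ⬝ᵥ (divVertex e z γ (adM τ t Y)) v`
(tracial `τ`). [folklore] -/
theorem divGerm_field_bondLetter (τ : 𝔸 →ₗ[ℝ] ℝ) (hτ : ∀ a b : 𝔸, τ (a * b) = τ (b * a)) (t : C → 𝔸) (e : D → Λ)
    (v : Λ × (C × D) → ℝ) (z : Λ) (γ : D) (Y : 𝔸) :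
    divGerm τ e (field t v) (bondLetter z γ Y) = v ⬝ᵥ (divVertex e z γ (adM τ t Y) *ᵥ v) := by
  rw [divGerm_bondLetter τ hτ, divVertex, dotProduct_sum_mulVec]
  refine Finset.sum_congr rfl fun μ _ => ?_
  rw [Matrix.sub_mulVec, dotProduct_sub, trace_br_field_field, trace_br_field_field]

/-- THE FAR-CORNER INSERTION of the plaquette `(s; α, β)`: `pairIns (s+e_β) (s+e_α) α β A − pairIns s s α β A`
(`[W_α(s+e_β), W_β(s+e_α)] − [W_α(s), W_β(s)]`).  A definition asserting nothing. [folklore] -/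
def farIns (e : D → Λ) (s : Λ) (α β : D) (A : Matrix C C ℝ) : Matrix (Λ × (C × D)) (Λ × (C × D)) ℝ :=
  pairIns (s + e β) (s + e α) α β A - pairIns s s α β A

omit [DecidableEq C] in
/-- its bilinear form is the far-corner plaquette reading. [folklore] -/
theorem trace_far_field (τ : 𝔸 →ₗ[ℝ] ℝ) (t : C → 𝔸) (e : D → Λ) (v : Λ × (C × D) → ℝ) (Y : 𝔸) (s : Λ) (α β : D) :
    τ (Y * (br (field t v (s + e β) α) (field t v (s + e α) β) - br (field t v s α) (field t v s β))) =
      v ⬝ᵥ (farIns e s α β (adM τ t Y) *ᵥ v) := by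
  rw [mul_sub, map_sub, trace_br_field_field, trace_br_field_field, farIns, Matrix.sub_mulVec, dotProduct_sub]

/-- THE FAR-CORNER SPIN-DIFFERENCE VERTEX `bondSum e z γ (farIns e · · · A)` (`8(d)` located pairs, minus the vanishing `μ = γ` ones).
A definition asserting nothing. [folklore] -/
def spinFarDiffVertex (e : D → Λ) (z : Λ) (γ : D) (A : Matrix C C ℝ) : Matrix (Λ × (C × D)) (Λ × (C × D)) ℝ :=
  bondSum e z γ fun s α β => farIns e s α β A

omit [DecidableEq C] in
/-- **THE FAR-CORNER SPIN DIFFERENCE IN COORDINATES**: `spinFarDiff τ e (field t v) (bondLetter z γ Y) = v ⬝ᵥ (spinFarDiffVertex e z γ (adM Y)) v`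
(any linear `τ`). [folklore] -/
theorem spinFarDiff_field_bondLetter (τ : 𝔸 →ₗ[ℝ] ℝ) (t : C → 𝔸) (e : D → Λ) (v : Λ × (C × D) → ℝ) (z : Λ) (γ : D) (Y : 𝔸) :
    spinFarDiff τ e (field t v) (bondLetter z γ Y) = v ⬝ᵥ (spinFarDiffVertex e z γ (adM τ t Y) *ᵥ v) :=
  collapse_quadratic τ e z γ Y
    (fun x μ ν => br (field t v (x + e ν) μ) (field t v (x + e μ) ν) - br (field t v x μ) (field t v x ν))
    (fun s α β => farIns e s α β (adM τ t Y)) v (fun s α β => trace_far_field τ t e v Y s α β)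

/-- THE DIFFERENCE INSERTION of the plaquette `(s; α, β)`: the located-pair expansion of
`pairDiff X Y (X′−X) (Y′−Y) = 2[X,Y′−Y] − 2[Y,X′−X] − [X,X′−X] + [Y,Y′−Y] − [Y′−Y,X′−X]` for `X = W_α(s)`, `Y = W_β(s)`, `X′ = W_α(s+e_β)`,
`Y′ = W_β(s+e_α)` (term by term, `16` located pairs).  A definition asserting nothing. [folklore] -/
def diffIns (e : D → Λ) (s : Λ) (α β : D) (A : Matrix C C ℝ) : Matrix (Λ × (C × D)) (Λ × (C × D)) ℝ :=
  (2 : ℝ) • (pairIns s (s + e α) α β A - pairIns s s α β A)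
    - (2 : ℝ) • (pairIns s (s + e β) β α A - pairIns s s β α A)
    - (pairIns s (s + e β) α α A - pairIns s s α α A)
    + (pairIns s (s + e α) β β A - pairIns s s β β A)
    - ((pairIns (s + e α) (s + e β) β α A - pairIns (s + e α) s β α A)
        - (pairIns s (s + e β) β α A - pairIns s s β α A))

omit [DecidableEq C] in
/-- its bilinear form is the `pairDiff` plaquette reading. [folklore] -/
theorem trace_diff_field (τ : 𝔸 →ₗ[ℝ] ℝ) (t : C → 𝔸) (e : D → Λ) (v : Λ × (C × D) → ℝ) (Y : 𝔸) (s : Λ) (α β : D) :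
    τ (Y * pairDiff (field t v s α) (field t v s β) (field t v (s + e β) α - field t v s α)
          (field t v (s + e α) β - field t v s β)) =
      v ⬝ᵥ (diffIns e s α β (adM τ t Y) *ᵥ v) := by
  simp only [pairDiff, br_sub_left, br_sub_right, two_mul, mul_add, mul_sub, map_add, map_sub, trace_br_field_field, diffIns,
    Matrix.add_mulVec, Matrix.sub_mulVec, Matrix.smul_mulVec, dotProduct_add, dotProduct_sub, dotProduct_smul, smul_eq_mul]
  abel

/-- THE SPIN-DIFFERENCE VERTEX `bondSum e z γ (diffIns e · · · A)`.  A definition asserting nothing. [folklore] -/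
def spinDiffVertex (e : D → Λ) (z : Λ) (γ : D) (A : Matrix C C ℝ) : Matrix (Λ × (C × D)) (Λ × (C × D)) ℝ :=
  bondSum e z γ fun s α β => diffIns e s α β A

omit [DecidableEq C] in
/-- **THE SPIN DIFFERENCE FORM IN COORDINATES**: `spinDiff τ e (field t v) (bondLetter z γ Y) = v ⬝ᵥ (spinDiffVertex e z γ (adM Y)) v`
(any linear `τ`). [folklore] -/
theorem spinDiff_field_bondLetter (τ : 𝔸 →ₗ[ℝ] ℝ) (t : C → 𝔸) (e : D → Λ) (v : Λ × (C × D) → ℝ) (z : Λ) (γ : D) (Y : 𝔸) :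
    spinDiff τ e (field t v) (bondLetter z γ Y) = v ⬝ᵥ (spinDiffVertex e z γ (adM τ t Y) *ᵥ v) :=
  collapse_quadratic τ e z γ Y
    (fun x μ ν => pairDiff (field t v x μ) (field t v x ν) (field t v (x + e ν) μ - field t v x μ)
      (field t v (x + e μ) ν - field t v x ν))
    (fun s α β => diffIns e s α β (adM τ t Y)) v (fun s α β => trace_diff_field τ t e v Y s α β)

/-- THE TRANSPORT INSERTION of the plaquette `(s; α, β)`: the located-pair expansion of `[W_α(s+e_β) + W_β(s), Z_{αβ}(s)]`,
`Z_{αβ}(s) = (W_β(s+e_α) − W_β(s)) − (W_α(s+e_β) − W_α(s))` (`8` located pairs).  A definition asserting nothing. [folklore] -/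
def transportIns (e : D → Λ) (s : Λ) (α β : D) (A : Matrix C C ℝ) : Matrix (Λ × (C × D)) (Λ × (C × D)) ℝ :=
  ((pairIns (s + e β) (s + e α) α β A - pairIns (s + e β) s α β A)
      - (pairIns (s + e β) (s + e β) α α A - pairIns (s + e β) s α α A))
    + ((pairIns s (s + e α) β β A - pairIns s s β β A) - (pairIns s (s + e β) β α A - pairIns s s β α A))

omit [DecidableEq C] in
/-- its bilinear form is the transport plaquette reading. [folklore] -/
theorem trace_transport_field (τ : 𝔸 →ₗ[ℝ] ℝ) (t : C → 𝔸) (e : D → Λ) (v : Λ × (C × D) → ℝ) (Y : 𝔸) (s : Λ) (α β : D) :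
    τ (Y * br (field t v (s + e β) α + field t v s β) (lcurl e (field t v) s α β)) =
      v ⬝ᵥ (transportIns e s α β (adM τ t Y) *ᵥ v) := by
  simp only [lcurl, br_add_left, br_sub_right, mul_add, mul_sub, map_add, map_sub, trace_br_field_field, transportIns,
    Matrix.add_mulVec, Matrix.sub_mulVec, dotProduct_add, dotProduct_sub]
  abel

/-- THE TRANSPORT `F`-VERTEX `bondSum e z γ (transportIns e · · · A)`.  A definition asserting nothing. [folklore] -/
def transportFVertex (e : D → Λ) (z : Λ) (γ : D) (A : Matrix C C ℝ) : Matrix (Λ × (C × D)) (Λ × (C × D)) ℝ :=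
  bondSum e z γ fun s α β => transportIns e s α β A

omit [DecidableEq C] in
/-- **THE TRANSPORT `F`-FORM IN COORDINATES**: `transportF τ e (field t v) (bondLetter z γ Y) = v ⬝ᵥ (transportFVertex e z γ (adM Y)) v`
(tracial `τ`). [folklore] -/
theorem transportF_field_bondLetter (τ : 𝔸 →ₗ[ℝ] ℝ) (hτ : ∀ a b : 𝔸, τ (a * b) = τ (b * a)) (t : C → 𝔸) (e : D → Λ)
    (v : Λ × (C × D) → ℝ) (z : Λ) (γ : D) (Y : 𝔸) :
    transportF τ e (field t v) (bondLetter z γ Y) = v ⬝ᵥ (transportFVertex e z γ (adM τ t Y) *ᵥ v) := by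
  have h : transportF τ e (field t v) (bondLetter z γ Y) =
      ∑ x, ∑ μ, ∑ ν, τ (lcurl e (bondLetter z γ Y) x μ ν *
        br (field t v (x + e ν) μ + field t v x ν) (lcurl e (field t v) x μ ν)) := by
    simp only [transportF, trace_mul_br_cycl τ hτ (lcurl e (field t v) _ _ _)]
  rw [h]
  exact collapse_quadratic τ e z γ Y (fun x μ ν => br (field t v (x + e ν) μ + field t v x ν) (lcurl e (field t v) x μ ν))
    (fun s α β => transportIns e s α β (adM τ t Y)) v (fun s α β => trace_transport_field τ t e v Y s α β)

/-- THE REMAINDER VERTEX of grading (t) ≥ 2: `−½•spinDiffVertex + transportFVertex − spinFarDiffVertex` (twice the matrix of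
`PlaquetteWeitzenbock.remainder = −¼·spinDiff + ½·transportF − ½·spinFarDiff`).  A definition asserting nothing. [folklore] -/
noncomputable def remVertex₁ (e : D → Λ) (z : Λ) (γ : D) (A : Matrix C C ℝ) : Matrix (Λ × (C × D)) (Λ × (C × D)) ℝ :=
  -((2 : ℝ)⁻¹ • spinDiffVertex e z γ A) + transportFVertex e z γ A - spinFarDiffVertex e z γ A

/-- **THE FIRST-ORDER VERTEX FAMILY OF THE WILSON ACTION** at the one-bond background `(z, γ)` with colour matrix `A`:
`wilsonVertex₁ := SpinTable.vecVertex sTot + 2•divVertex + remVertex₁` = MODEL VECTOR VERTEX (`current ⊗ 1 + sTot•spinVertex`,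
`sTot = −2`) + LONGITUDINAL VERTEX + REMAINDER VERTEX — one finite matrix on `Λ × (C × D)`, every block a located pair within two
lattice steps of `z`.  A definition asserting nothing. [folklore] -/
noncomputable def wilsonVertex₁ (e : D → Λ) (z : Λ) (γ : D) (A : Matrix C C ℝ) : Matrix (Λ × (C × D)) (Λ × (C × D)) ℝ :=
  vecVertex sTot e z γ A + (2 : ℝ) • divVertex e z γ A + remVertex₁ e z γ A

end Vertices

/-! ## §4 Headline: the Wilson action's `B`-linear one-bond Hessian vertex is ONE finite stencil matrix -/

section Headline

variable {𝔸 : Type*} [NormedRing 𝔸] [NormedAlgebra ℝ 𝔸]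
variable {Λ : Type*} [Fintype Λ] [DecidableEq Λ] [AddCommGroup Λ] {C : Type*} [Fintype C] [DecidableEq C]
  {D : Type*} [Fintype D] [DecidableEq D]

omit [DecidableEq C] in
/-- the explicit remainder of `PlaquetteWeitzenbock.actionJet21_eq_vecVertex` in coordinates: `remainder = ½·v ⬝ᵥ (remVertex₁ …) v`.
[folklore] -/
theorem remainder_field_bondLetter (τ : 𝔸 →ₗ[ℝ] ℝ) (hτ : ∀ a b : 𝔸, τ (a * b) = τ (b * a)) (t : C → 𝔸) (e : D → Λ)
    (v : Λ × (C × D) → ℝ) (z : Λ) (γ : D) (Y : 𝔸) :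
    remainder τ e (field t v) (bondLetter z γ Y) = (2 : ℝ)⁻¹ * (v ⬝ᵥ (remVertex₁ e z γ (adM τ t Y) *ᵥ v)) := by
  rw [remainder, spinDiff_field_bondLetter, transportF_field_bondLetter τ hτ, spinFarDiff_field_bondLetter, remVertex₁,
    Matrix.sub_mulVec, Matrix.add_mulVec, Matrix.neg_mulVec, Matrix.smul_mulVec, dotProduct_sub, dotProduct_add, dotProduct_neg,
    dotProduct_smul, smul_eq_mul]
  ring

omit [DecidableEq C] in
/-- **HEADLINE — THE WILSON ACTION'S FIRST-ORDER ONE-BOND HESSIAN VERTEX IS THE FINITE STENCIL MATRIX `wilsonVertex₁`.**  In the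
Hessian convention `S₂ = ½·vᵀHv` for `S = Σ_p (1 − Re τU(∂p))` (`(2,1)`-jet `= −½·jet21`, `PlaquetteVertex` header; B9 (3.7)/(3.10)/(3.12)
are where the printed object lives — context only), at the one-bond background `(z, γ, Y)`, for EVERY fluctuation in coordinates `v`
and every tracial `τ`:  `−½·jet21 ℝ τ e (field t v) (bondLetter z γ Y) = ½ · v ⬝ᵥ (wilsonVertex₁ e z γ (adM τ t Y) *ᵥ v)`. [folklore] -/
theorem actionJet21_eq_wilsonVertex₁ (τ : 𝔸 →ₗ[ℝ] ℝ) (hτ : ∀ a b : 𝔸, τ (a * b) = τ (b * a)) (t : C → 𝔸) (e : D → Λ)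
    (v : Λ × (C × D) → ℝ) (z : Λ) (γ : D) (Y : 𝔸) :
    -((2 : ℝ)⁻¹ * jet21 ℝ τ e (field t v) (bondLetter z γ Y)) = (2 : ℝ)⁻¹ * (v ⬝ᵥ (wilsonVertex₁ e z γ (adM τ t Y) *ᵥ v)) := by
  rw [actionJet21_eq_vecVertex τ hτ, divGerm_field_bondLetter τ hτ, remainder_field_bondLetter τ hτ, wilsonVertex₁, Matrix.add_mulVec,
    Matrix.add_mulVec, Matrix.smul_mulVec, dotProduct_add, dotProduct_add, dotProduct_smul, smul_eq_mul]
  ring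

omit [DecidableEq C] in
/-- the same with the three vertices displayed: `−½·jet21 = ½·vᵀ(vecVertex sTot)v + vᵀ(divVertex)v + ½·vᵀ(remVertex₁)v`. [folklore] -/
theorem actionJet21_eq_three_vertices (τ : 𝔸 →ₗ[ℝ] ℝ) (hτ : ∀ a b : 𝔸, τ (a * b) = τ (b * a)) (t : C → 𝔸) (e : D → Λ)
    (v : Λ × (C × D) → ℝ) (z : Λ) (γ : D) (Y : 𝔸) :
    -((2 : ℝ)⁻¹ * jet21 ℝ τ e (field t v) (bondLetter z γ Y)) =
      (2 : ℝ)⁻¹ * (v ⬝ᵥ (vecVertex sTot e z γ (adM τ t Y) *ᵥ v)) + v ⬝ᵥ (divVertex e z γ (adM τ t Y) *ᵥ v)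
        + (2 : ℝ)⁻¹ * (v ⬝ᵥ (remVertex₁ e z γ (adM τ t Y) *ᵥ v)) := by
  rw [actionJet21_eq_vecVertex τ hτ, divGerm_field_bondLetter τ hτ, remainder_field_bondLetter τ hτ]

end Headline

/-! ## §5 Bałaban's letters verbatim -/

section BalabanLetters

open ColourTrace

attribute [local instance] Matrix.linftyOpNormedRing Matrix.linftyOpNormedAlgebra

variable {N : ℕ} {C : Type*} [Fintype C] [DecidableEq C]
variable {Λ : Type*} [Fintype Λ] [DecidableEq Λ] [AddCommGroup Λ] {D : Type*} [Fintype D] [DecidableEq D]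

omit [DecidableEq C] in
/-- **BAŁABAN'S LETTERS VERBATIM**: for a generator family `τ : C → Matrix (Fin N) (Fin N) ℂ` with the real normalised trace `rntr`,
fluctuation `field (gen τ) v` and background letter `gen τ c` on the bond `(z, γ)`:
`−½·jet21 = ½·v ⬝ᵥ (wilsonVertex₁ e z γ (ColourTrace.adMat τ (τ c)) *ᵥ v)` — the first-order vertex family with Bałaban's very colour
matrix (no hypothesis on the generator family; any submultiplicative matrix norm, enabled locally as in `PlaquetteVertex` §4). [folklore] -/
theorem actionJet21_eq_wilsonVertex₁_gen (τ : C → Matrix (Fin N) (Fin N) ℂ) (e : D → Λ) (v : Λ × (C × D) → ℝ) (z : Λ) (γ : D)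
    (c : C) :
    -((2 : ℝ)⁻¹ * jet21 ℝ rntr e (field (gen τ) v) (bondLetter z γ (gen τ c))) =
      (2 : ℝ)⁻¹ * (v ⬝ᵥ (wilsonVertex₁ e z γ (adMat τ (τ c)) *ᵥ v)) := by
  rw [actionJet21_eq_wilsonVertex₁ rntr rntr_comm (gen τ) e v z γ (gen τ c), adM_gen]

end BalabanLetters

/-! ## §6 Support bookkeeping and sanity examples -/

section Support

variable {Λ : Type*} [DecidableEq Λ] {C : Type*} {D : Type*} [DecidableEq D]

/-- a located pair is supported on its row site. [folklore] -/
theorem pairIns_apply_of_ne_left (x y : Λ) (α β : D) (A : Matrix C C ℝ) (p q : Λ × (C × D)) (hp : p.1 ≠ x) :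
    pairIns x y α β A p q = 0 := by
  rw [pairIns, elemIns_apply, if_neg (fun h => hp h.1)]

/-- a located pair is supported on its column site. [folklore] -/
theorem pairIns_apply_of_ne_right (x y : Λ) (α β : D) (A : Matrix C C ℝ) (p q : Λ × (C × D)) (hq : q.1 ≠ y) :
    pairIns x y α β A p q = 0 := by
  rw [pairIns, elemIns_apply, if_neg (fun h => hq h.2)]

end Support

section Examples

variable {C : Type*} [Fintype C] [DecidableEq C] {D : Type*} [Fintype D] [DecidableEq D]

/-- sanity: the direction block of the zero colour matrix vanishes. [folklore] -/
example (α β : D) : dirBlock α β (0 : Matrix C C ℝ) = 0 := by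
  ext ⟨a, k⟩ ⟨b, k'⟩
  simp [dirBlock_apply]

/-- sanity: the diagonal spin matrix vanishes, consistently with `spinMat_eq_dirBlock_sub`. [folklore] -/
example (β : D) (A : Matrix C C ℝ) : dirBlock β β A - dirBlock β β A = spinMat β β A := by
  rw [sub_self, SpinTable.spinMat_self]

end Examples

end Literature.MathematicalPhysics.QuantumFieldTheory.Balaban1983to89.Beta.PlaquetteStencil
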